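/-
Origin: expansion seat `planner-pub-hodgecm-mc-unitary-1-g6-0`, handover #1 r1 2026-08-19T16:32:33Z md5 80200e833226 (224 l.; NEW additive leaf, RUN 36+ after unitary-1-g5 #1 `Model/WmInstanceV2.lean`; ns HodgeCM.Model; decls: `archIsotropyRegime V hV τ T hT : ↥(UnitaryGroup.archIsotropy L V.Hm τ T hT) →* ↥(Adelic.regimeSubgroup L V.Hm)` (= regimeEquiv hV ∘ (cmAdelicEquiv 3 V.Hm)⁻¹ ∘ UnitaryGroup.archIsotropyToAdelic; binder-1's `gK`), `coe_archIsotropyRegime` (rfl), `cmFrameEquiv_archIsotropyRegime` (currency identity §64.4, any CM frame, rfl), `WmInput.hSK_of_reindex` (pure logic), `wmInputCM₂_eV_archIsotropyRegime` (rfl), `wmInputCM₂_mem_SK_iff`, and binder-1's `hSK` VERBATIM at Kι := K_∞ / gK := archIsotropyRegime / χ := archKappa for the records `wmInputCM₂` (generic η), `wmInputCM₂b` (block of record), `wmInputCM₂s`, `wmInputCM₂s'`: `wmInputCM₂_hSK` / `wmInputCM₂b_hSK` / `wmInputCM₂s_hSK` / `wmInputCM₂s'_hSK`; kernel only) (`HOME/mc/pub-hodgecm-mc-unitary-1-g6/work/pkg/HodgeCM/Model/WmInstanceV2KType.lean`,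 md5 80200e83, 224 lines);
landed by the gen-12 packager (p-g12) in gate run 36 as `HodgeCM/Model/WmInstanceV2KType.lean` (verbatim).
-/
/-
Origin: speedrun cell pub-hodgecm, MODEL-CONSTRUCTION sub-cell, lineage mc-unitary-1 (node W2-Kn «K-norm», MODEL-DAG §1),
seat planner-pub-hodgecm-mc-unitary-1-g6-0 (gen 6), 2026-08-19.  EXPORT (x-W) of BINDER-TRIAGE §63/§64 = the hypothesis `hSK` of
binder-1's `HodgeCM/Model/Binders/Gen12WedgeKType.lean` (`wedgeMem_of_kType` / `SeesawCore.ofKType`, stage md5 2c1e0702e572), VERBATIM,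
at the v2 input records of `HodgeCM/Model/WmInstanceV2.lean` (this lineage, RUN-36 row #1, md5 8d00ccf342cf) with
  `Kι := ↥(UnitaryGroup.archIsotropy L V.Hm τ T hT)` (= K_∞, the stabiliser of the base point in the ball frame `T` at `τ`),
  `gK := archIsotropyRegime V hV τ T hT` (this file: `K_∞ →* ↥(Adelic.regimeSubgroup L V.Hm)`, `k ↦ (k, 1_f)`),
  `χ  := fun k => ((UnitaryGroup.archKappa L V.Hm τ T hT k : ℂˣ) : ℂ)` (= det of the `V⁻`-block, binder-1's `hdet` currency).
Target in PKG: `HodgeCM/Model/WmInstanceV2KType.lean` (NEW additive leaf; install AFTER `HodgeCM/Model/WmInstanceV2.lean`; nothing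
imports it until binder-1 / node E do).  KERNEL only: ONE def (`archIsotropyRegime` = composite of three existing monoid homs) and
theorems; 0 records, 0 `Prop` definitions, 0 cited binders, no placeholder proof; MODEL-N ±0.
CERTIFICATE: (i) tree-side shadow `HOME/mc/pub-hodgecm-mc-unitary-1-g6/work/shadow_ktype_cert.lean` — PKG `WmInput`,
`Adelic.regimeSubgroup`, `Adelic.regimeEquiv` copied field-for-field over the tree originals of the vendored twins (junction J0(d) `rfl`,
`Model/Junction/TreeTwins.lean`), every declaration below transcribed 1:1 — farm `lean check` rc 0 / 0 warnings / no placeholder proof / 31.6 s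
(2026-08-19T17:05Z); (ii) PKG-side: see the seat's STATUS line / HANDOFF.md (light scratch of § KInfty + § Reindex against the RUN-35 build).
ELABORATION NOTE for consumers (measured, shadow probes X1/X11/X12 vs X9/X13/X14): each export below is proved DIRECTLY from the tree lemma
`mem_cmKTypeTwist_iff` at ITS OWN record term.  Do NOT derive the statement for one record (`wmInputCM₂b …`, `wmInputCM₂s' …`, or a
further `def` wrapping one of them) from the lemma of another by `exact` / `rfl`-transport: unifying two of these record TERMS
(`wmInputCM₂b … =?= wmInputCM₂ … η₀ …`, even by `rfl`) times out at `whnf` (200000 heartbeats, not lifted by `set_option maxHeartbeats`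
on the farm), whereas projection-vs-term unification (`(W).SK`, `(W).ρ ((W).eV _, 1)` against the tree lemma) passes at default
heartbeats through 1, 2 and 3 definition layers.  If you wrap a record in your own `def W' := wmInputCM₂s' …`, re-derive `hSK` for `W'`
by the same one-liner `fun Ψ h => (mem_cmKTypeTwist_iff … Ψ).2 h` (arguments as in `wmInputCM₂s'_hSK` below).
-/
import Summits.HodgeConjecture.HodgeCM.Model.WmInstanceV2

-- G11b-3 recipe (port D30 slow-export class; ops-buildfix LEDGER B13-1/B13-3): elaborate sequentially so the trailing
-- `attribute [implicit_reducible]` block (reducibilityCoreExt is keyed to the async environment branch) is in force at `.olean` export.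
set_option Elab.async false

noncomputable section

namespace HodgeCM.Model

open HodgeCM.Adelic Literature.NumberTheory.Weil1964 Literature.NumberTheory.Automorphic NumberField
open Literature.NumberTheory.GelbartRogawski1991.UnitaryDualPair
open Literature.RepresentationTheory.HeisenbergGroup
open scoped Matrix

variable {L : CMField} {ι₁ : L →+* ℂ}

/-! ### K_∞ in the regime model group -/
section KInfty

variable (V : HermSpace3 L ι₁) (hV : IsAnisotropic L V.Hm) (τ : L →+* ℂ) (T : GL (Fin 3) ℂ)
  (hT : formCongr (starRingEnd ℂ) T (V.Hm.map τ) = Literature.Geometry.ComplexHyperbolic.BallModel.J)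

/-- **`K_∞ → the model group of `wm V c`**: the archimedean isotropy group `K_∞ = Stab(x₀) ≤ U(V)(ℝ)_τ` (tree
`UnitaryGroup.archIsotropy`, ball frame `T` at `τ`) mapped into `↥(Adelic.regimeSubgroup L V.Hm)` as `k ↦ (k at τ, 1 elsewhere)`:
`Adelic.regimeEquiv hV ∘ (cmAdelicEquiv 3 V.Hm)⁻¹ ∘ UnitaryGroup.archIsotropyToAdelic`.  This is binder-1's family `gK`. -/
def archIsotropyRegime :
    ↥(UnitaryGroup.archIsotropy (L : Type) V.Hm τ T hT) →* ↥(Adelic.regimeSubgroup L V.Hm) :=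
  (Adelic.regimeEquiv L V.Hm hV).toMonoidHom.comp
    ((cmAdelicEquiv (L : Type) 3 V.Hm).symm.toMonoidHom.comp (UnitaryGroup.archIsotropyToAdelic (L : Type) V.Hm τ T hT))

/-- (Ported verbatim from the HodgeCMPerL package; no docstring in the source.) -/
theorem coe_archIsotropyRegime (k : ↥(UnitaryGroup.archIsotropy (L : Type) V.Hm τ T hT)) :
    (archIsotropyRegime V hV τ T hT k : ↥(Adelic.adelicUnitaryGroup L V.Hm)) =
      (cmAdelicEquiv (L : Type) 3 V.Hm).symm (UnitaryGroup.archIsotropyToAdelic (L : Type) V.Hm τ T hT k) := rfl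

/-- **currency identity** (model1 §64.4, for glue-1 / theta-3): in ANY CM frame `g` of `V.Hm` (`ḡᵀ Hm g = diag dV`) the frame
transport of `gK k` is the tree's `cmKTypeHom` of the archimedean point — definitionally. -/
theorem cmFrameEquiv_archIsotropyRegime (g : GL (Fin 3) L) (dV : Fin 3 → L)
    (hg : ((g : Matrix (Fin 3) (Fin 3) L).map (cmConjRingHom (L : Type)))ᵀ * V.Hm * (g : Matrix (Fin 3) (Fin 3) L) =
      Matrix.diagonal dV)
    (k : ↥(UnitaryGroup.archIsotropy (L : Type) V.Hm τ T hT)) :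
    cmFrameEquiv (L : Type) g V.Hm dV hg (archIsotropyRegime V hV τ T hT k : ↥(Adelic.adelicUnitaryGroup L V.Hm)) =
      cmKTypeHom (L : Type) V.Hm g dV hg (UnitaryGroup.archIsotropyToAdelic (L : Type) V.Hm τ T hT k) := rfl

end KInfty

/-! ### re-indexing the family (binder-1 may index `gK` by another type) -/
section Reindex

variable {V : HermSpace3 L ι₁} {S : StubTree.SeesawDatum L}

/-- (x-W) is contravariant in the index: if `hSK` holds along `(gK, χ) : Kι → …` and `f : Kι → Kι'` intertwines `(gK, χ)` with
`(gK', χ')`, then `hSK` holds along `(gK', χ')` (more eigen-conditions, same conclusion).  Pure logic. -/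
theorem WmInput.hSK_of_reindex (W : WmInput V S) {Kι Kι' : Type*}
    (gK : Kι → ↥(Adelic.regimeSubgroup L V.Hm)) (χ : Kι → ℂ) (gK' : Kι' → ↥(Adelic.regimeSubgroup L V.Hm)) (χ' : Kι' → ℂ)
    (f : Kι → Kι') (hg : ∀ k, gK' (f k) = gK k) (hχ : ∀ k, χ' (f k) = χ k)
    (hSK : ∀ Ψ : piSchwartzBruhat W.F W.ι,
      (∀ k : Kι, ((W.ρ (W.eV (gK k : ↥(Adelic.adelicUnitaryGroup L V.Hm)), 1)) :
          Module.End ℂ (piSchwartzBruhat W.F W.ι)) Ψ = χ k • Ψ) → Ψ ∈ W.SK) :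
    ∀ Ψ : piSchwartzBruhat W.F W.ι,
      (∀ k' : Kι', ((W.ρ (W.eV (gK' k' : ↥(Adelic.adelicUnitaryGroup L V.Hm)), 1)) :
          Module.End ℂ (piSchwartzBruhat W.F W.ι)) Ψ = χ' k' • Ψ) → Ψ ∈ W.SK :=
  fun Ψ h => hSK Ψ fun k => by rw [← hg, ← hχ]; exact h (f k)

end Reindex

/-! ### (x-W) at the generic-`η` record `wmInputCM₂` -/
section V2K

variable (V : HermSpace3 L ι₁) (S : StubTree.SeesawDatum L) (hV : IsAnisotropic L V.Hm)

variable
  (hGR : (cmSplittingDatum (L : Type) finProdFinEquiv (frameD V) (frameD_real V) (frameD_ne V) (dW S) (dW_real S) (dW_ne S)).CompatibleSplitting)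
  (hρ : HasThetaMajorants fun (p : CMAdelic (L : Type) (frameD V) × CMAdelic (L : Type) (dW S)) (Φ : CMSchwartz (L : Type) 6) =>
      adelicMpCont.omega (↥(maximalRealSubfield L)) (Fin 6)
        (CMGram (L : Type) finProdFinEquiv (frameD V) (frameD_real V) (dW S) (dW_real S))
        (cmPairSplitting (L : Type) finProdFinEquiv (frameD V) (frameD_real V) (frameD_ne V) (dW S) (dW_real S) (dW_ne S) hGR p) Φ)
  (η : CMAdelic (L : Type) (frameD V) × CMAdelic (L : Type) (dW S) →* ℂˣ)
  (hη : ∀ γU ∈ CMRat (L : Type) (frameD V), ∀ γ ∈ CMRat (L : Type) (dW S), η (γU, γ) = 1)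
  (hηc : Continuous fun p => ((η p : ℂˣ) : ℂ))

/-- along `K_∞` the model's `eV ∘ gK` is the tree's `cmKTypeHom` in the rational frame of record (definitional). -/
theorem wmInputCM₂_eV_archIsotropyRegime (hδ : 0 < (ι₁ (imagUnit L)).im) (τ : L →+* ℂ) (T : GL (Fin 3) ℂ)
    (hT : formCongr (starRingEnd ℂ) T (V.Hm.map τ) = Literature.Geometry.ComplexHyperbolic.BallModel.J)
    (k : ↥(UnitaryGroup.archIsotropy (L : Type) V.Hm τ T hT)) :
    (wmInputCM₂ V S hGR hρ η hη hηc hδ τ T hT).eV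
        (archIsotropyRegime V hV τ T hT k : ↥(Adelic.adelicUnitaryGroup L V.Hm)) =
      cmKTypeHom (L : Type) V.Hm (frameG V) (frameD V) (frame_congr V) (UnitaryGroup.archIsotropyToAdelic (L : Type) V.Hm τ T hT k) :=
  rfl

/-- **membership in `SK = 𝒮^κ(η)`** ↔ `K_∞`-eigen for `archKappa` through the model's OWN action `ρ ∘ (eV ∘ gK, 1)`
(tree `mem_cmKTypeTwist_iff`, read through the record's projections). -/
theorem wmInputCM₂_mem_SK_iff (hδ : 0 < (ι₁ (imagUnit L)).im) (τ : L →+* ℂ) (T : GL (Fin 3) ℂ)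
    (hT : formCongr (starRingEnd ℂ) T (V.Hm.map τ) = Literature.Geometry.ComplexHyperbolic.BallModel.J)
    (Ψ : piSchwartzBruhat (wmInputCM₂ V S hGR hρ η hη hηc hδ τ T hT).F (wmInputCM₂ V S hGR hρ η hη hηc hδ τ T hT).ι) :
    Ψ ∈ (wmInputCM₂ V S hGR hρ η hη hηc hδ τ T hT).SK ↔
      ∀ k : ↥(UnitaryGroup.archIsotropy (L : Type) V.Hm τ T hT),
        (((wmInputCM₂ V S hGR hρ η hη hηc hδ τ T hT).ρ
            ((wmInputCM₂ V S hGR hρ η hη hηc hδ τ T hT).eV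
              (archIsotropyRegime V hV τ T hT k : ↥(Adelic.adelicUnitaryGroup L V.Hm)), 1)) :
            Module.End ℂ (piSchwartzBruhat (wmInputCM₂ V S hGR hρ η hη hηc hδ τ T hT).F
              (wmInputCM₂ V S hGR hρ η hη hηc hδ τ T hT).ι)) Ψ =
          ((UnitaryGroup.archKappa (L : Type) V.Hm τ T hT k : ℂˣ) : ℂ) • Ψ :=
  mem_cmKTypeTwist_iff (L : Type) finProdFinEquiv (frameD V) (frameD_real V) (frameD_ne V) (dW S) (dW_real S) (dW_ne S) hGR η
    V.Hm (frameG V) (frame_congr V) τ T hT (UnitaryGroup.archKappa (L : Type) V.Hm τ T hT) Ψ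

/-- **(x-W) at `wmInputCM₂`** — binder-1's `hSK` verbatim (`W V c ↦ wmInputCM₂ V S …`, `Kι := K_∞`, `gK := archIsotropyRegime`,
`χ := archKappa`). -/
theorem wmInputCM₂_hSK (hδ : 0 < (ι₁ (imagUnit L)).im) (τ : L →+* ℂ) (T : GL (Fin 3) ℂ)
    (hT : formCongr (starRingEnd ℂ) T (V.Hm.map τ) = Literature.Geometry.ComplexHyperbolic.BallModel.J) :
    ∀ Ψ : piSchwartzBruhat (wmInputCM₂ V S hGR hρ η hη hηc hδ τ T hT).F (wmInputCM₂ V S hGR hρ η hη hηc hδ τ T hT).ι,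
      (∀ k : ↥(UnitaryGroup.archIsotropy (L : Type) V.Hm τ T hT),
        (((wmInputCM₂ V S hGR hρ η hη hηc hδ τ T hT).ρ
            ((wmInputCM₂ V S hGR hρ η hη hηc hδ τ T hT).eV
              (archIsotropyRegime V hV τ T hT k : ↥(Adelic.adelicUnitaryGroup L V.Hm)), 1)) :
            Module.End ℂ (piSchwartzBruhat (wmInputCM₂ V S hGR hρ η hη hηc hδ τ T hT).F
              (wmInputCM₂ V S hGR hρ η hη hηc hδ τ T hT).ι)) Ψ =
          ((UnitaryGroup.archKappa (L : Type) V.Hm τ T hT k : ℂˣ) : ℂ) • Ψ) →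
      Ψ ∈ (wmInputCM₂ V S hGR hρ η hη hηc hδ τ T hT).SK :=
  fun Ψ h => (wmInputCM₂_mem_SK_iff V S hV hGR hρ η hη hηc hδ τ T hT Ψ).2 h

end V2K

/-! ### (x-W) at the E-facing records `wmInputCM₂b`, `wmInputCM₂s`, `wmInputCM₂s'` -/
section V2cK

variable (V : HermSpace3 L ι₁) (S : StubTree.SeesawDatum L) (hV : IsAnisotropic L V.Hm)

variable
  (hGR : (cmSplittingDatum (L : Type) finProdFinEquiv (frameD V) (frameD_real V) (frameD_ne V) (dW S) (dW_real S) (dW_ne S)).CompatibleSplitting)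
  (hρ : HasThetaMajorants fun (p : CMAdelic (L : Type) (frameD V) × CMAdelic (L : Type) (dW S)) (Φ : CMSchwartz (L : Type) 6) =>
      adelicMpCont.omega (↥(maximalRealSubfield L)) (Fin 6)
        (CMGram (L : Type) finProdFinEquiv (frameD V) (frameD_real V) (dW S) (dW_real S))
        (cmPairSplitting (L : Type) finProdFinEquiv (frameD V) (frameD_real V) (frameD_ne V) (dW S) (dW_real S) (dW_ne S) hGR p) Φ)
  (χV χW : ContinuousMonoidHom
    (relNormOneIdeles (maximalRealSubfield (L : Type)) (L : Type) ⧸ relNormOneRat (maximalRealSubfield (L : Type)) (L : Type)) Circle)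

/-- **(x-W) at the block of record `wmInputCM₂b`** (`η = (χ_V∘det) ⊠ (χ_W∘det)`), proved directly from the tree lemma
`mem_cmKTypeTwist_iff` with the block's twist character spelled out. -/
theorem wmInputCM₂b_hSK (hδ : 0 < (ι₁ (imagUnit L)).im) (τ : L →+* ℂ) (T : GL (Fin 3) ℂ)
    (hT : formCongr (starRingEnd ℂ) T (V.Hm.map τ) = Literature.Geometry.ComplexHyperbolic.BallModel.J) :
    ∀ Ψ : piSchwartzBruhat (wmInputCM₂b V S hGR hρ χV χW hδ τ T hT).F (wmInputCM₂b V S hGR hρ χV χW hδ τ T hT).ι,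
      (∀ k : ↥(UnitaryGroup.archIsotropy (L : Type) V.Hm τ T hT),
        (((wmInputCM₂b V S hGR hρ χV χW hδ τ T hT).ρ
            ((wmInputCM₂b V S hGR hρ χV χW hδ τ T hT).eV
              (archIsotropyRegime V hV τ T hT k : ↥(Adelic.adelicUnitaryGroup L V.Hm)), 1)) :
            Module.End ℂ (piSchwartzBruhat (wmInputCM₂b V S hGR hρ χV χW hδ τ T hT).F
              (wmInputCM₂b V S hGR hρ χV χW hδ τ T hT).ι)) Ψ =
          ((UnitaryGroup.archKappa (L : Type) V.Hm τ T hT k : ℂˣ) : ℂ) • Ψ) →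
      Ψ ∈ (wmInputCM₂b V S hGR hρ χV χW hδ τ T hT).SK :=
  fun Ψ h =>
    (mem_cmKTypeTwist_iff (L : Type) finProdFinEquiv (frameD V) (frameD_real V) (frameD_ne V) (dW S) (dW_real S) (dW_ne S) hGR
      (cmDetTwistChar (L : Type) (frameD V) (frameD_ne V) (dW S) (dW_ne S)
        (charOfUnitaryLineChar (L : Type) χV) (charOfUnitaryLineChar (L : Type) χW))
      V.Hm (frameG V) (frame_congr V) τ T hT (UnitaryGroup.archKappa (L : Type) V.Hm τ T hT) Ψ).2 h

/-- **(x-W) at `wmInputCM₂s`** (`hρ` discharged from the three sign facts). -/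
theorem wmInputCM₂s_hSK
    (h₁V : ∃ i₀ : Fin 3, (∀ i, i ≠ i₀ → 0 < (ι₁ ((frameD V) i)).re) ∨ ∀ i, i ≠ i₀ → (ι₁ ((frameD V) i)).re < 0)
    (h₁W : (∀ j, 0 < (ι₁ ((dW S) j)).re) ∨ ∀ j, (ι₁ ((dW S) j)).re < 0)
    (hVτ : ∀ τ' : (L : Type) →+* ℂ, NumberField.InfinitePlace.mk τ' ≠ NumberField.InfinitePlace.mk ι₁ →
      (∀ i, 0 < (τ' ((frameD V) i)).re) ∨ ∀ i, (τ' ((frameD V) i)).re < 0)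
    (hδ : 0 < (ι₁ (imagUnit L)).im) (τ : L →+* ℂ) (T : GL (Fin 3) ℂ)
    (hT : formCongr (starRingEnd ℂ) T (V.Hm.map τ) = Literature.Geometry.ComplexHyperbolic.BallModel.J) :
    ∀ Ψ : piSchwartzBruhat (wmInputCM₂s V S hGR χV χW h₁V h₁W hVτ hδ τ T hT).F
        (wmInputCM₂s V S hGR χV χW h₁V h₁W hVτ hδ τ T hT).ι,
      (∀ k : ↥(UnitaryGroup.archIsotropy (L : Type) V.Hm τ T hT),
        (((wmInputCM₂s V S hGR χV χW h₁V h₁W hVτ hδ τ T hT).ρ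
            ((wmInputCM₂s V S hGR χV χW h₁V h₁W hVτ hδ τ T hT).eV
              (archIsotropyRegime V hV τ T hT k : ↥(Adelic.adelicUnitaryGroup L V.Hm)), 1)) :
            Module.End ℂ (piSchwartzBruhat (wmInputCM₂s V S hGR χV χW h₁V h₁W hVτ hδ τ T hT).F
              (wmInputCM₂s V S hGR χV χW h₁V h₁W hVτ hδ τ T hT).ι)) Ψ =
          ((UnitaryGroup.archKappa (L : Type) V.Hm τ T hT k : ℂˣ) : ℂ) • Ψ) →
      Ψ ∈ (wmInputCM₂s V S hGR χV χW h₁V h₁W hVτ hδ τ T hT).SK :=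
  fun Ψ h =>
    (mem_cmKTypeTwist_iff (L : Type) finProdFinEquiv (frameD V) (frameD_real V) (frameD_ne V) (dW S) (dW_real S) (dW_ne S) hGR
      (cmDetTwistChar (L : Type) (frameD V) (frameD_ne V) (dW S) (dW_ne S)
        (charOfUnitaryLineChar (L : Type) χV) (charOfUnitaryLineChar (L : Type) χW))
      V.Hm (frameG V) (frame_congr V) τ T hT (UnitaryGroup.archKappa (L : Type) V.Hm τ T hT) Ψ).2 h

/-- **(x-W) at `wmInputCM₂s'`** (`hρ` discharged, `V`-side signs read off `HermSpace3`; the record node E instantiates). -/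
theorem wmInputCM₂s'_hSK
    (h₁W : (∀ j, 0 < (ι₁ ((dW S) j)).re) ∨ ∀ j, (ι₁ ((dW S) j)).re < 0)
    (hδ : 0 < (ι₁ (imagUnit L)).im) (τ : L →+* ℂ) (T : GL (Fin 3) ℂ)
    (hT : formCongr (starRingEnd ℂ) T (V.Hm.map τ) = Literature.Geometry.ComplexHyperbolic.BallModel.J) :
    ∀ Ψ : piSchwartzBruhat (wmInputCM₂s' V S hGR χV χW h₁W hδ τ T hT).F (wmInputCM₂s' V S hGR χV χW h₁W hδ τ T hT).ι,
      (∀ k : ↥(UnitaryGroup.archIsotropy (L : Type) V.Hm τ T hT),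
        (((wmInputCM₂s' V S hGR χV χW h₁W hδ τ T hT).ρ
            ((wmInputCM₂s' V S hGR χV χW h₁W hδ τ T hT).eV
              (archIsotropyRegime V hV τ T hT k : ↥(Adelic.adelicUnitaryGroup L V.Hm)), 1)) :
            Module.End ℂ (piSchwartzBruhat (wmInputCM₂s' V S hGR χV χW h₁W hδ τ T hT).F
              (wmInputCM₂s' V S hGR χV χW h₁W hδ τ T hT).ι)) Ψ =
          ((UnitaryGroup.archKappa (L : Type) V.Hm τ T hT k : ℂˣ) : ℂ) • Ψ) →
      Ψ ∈ (wmInputCM₂s' V S hGR χV χW h₁W hδ τ T hT).SK :=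
  fun Ψ h =>
    (mem_cmKTypeTwist_iff (L : Type) finProdFinEquiv (frameD V) (frameD_real V) (frameD_ne V) (dW S) (dW_real S) (dW_ne S) hGR
      (cmDetTwistChar (L : Type) (frameD V) (frameD_ne V) (dW S) (dW_ne S)
        (charOfUnitaryLineChar (L : Type) χV) (charOfUnitaryLineChar (L : Type) χW))
      V.Hm (frameG V) (frame_congr V) τ T hT (UnitaryGroup.archKappa (L : Type) V.Hm τ T hT) Ψ).2 h

end V2cK


end HodgeCM.Model

end
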